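import Summits.ResolutionOfSingularities.ResolutionOfSingularities.Theorems.PurelyInseparableDim4JointForestDepthTwoKit
import HarnessLib

/-!
# Purely inseparable four-folds: the FINITE-PLAN CERTIFICATE KIT for the monotone joint forest — one coordinate member and an
# explicitly enumerated finite plan of any depth, ranked (brick S3 (c) «joint point∘coordinate chains», part 28, cell `res-dim4-pi`)

[OURS · counted 0] (D-0157 DOOR 2; desk WORD #66 (4)(c), #74 (g), #99 (d); frame `PIDim4.TerminationImpliesOrderReduction`,
S3 (c); host item stmt-ResolutionOfSingularities-16155, helper). Nothing here proves resolution of singularities in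
dimension ≥ 4 / characteristic `p` — NOT here, not anywhere in this programme.

Part 25's kit is depth two (children dead). Here the plan may have ANY finite depth: the certificate writer supplies the rules
`plan`, `leaves`, a finite set `Q` of `(state, centre)` pairs containing the root pair and CLOSED under the child map, and a RANK
`rk : State × Finset → ℕ` strictly decreasing along plan edges (this discharges reachability and `Acc`); the hereditary conditions of
part 21 are then asked for the members of `Q` only, and the leaves' point walks must be EMPTY (dead leaves; a live point walk needs
part 21 itself).

* `acc_plan_of_rank` — `Acc` of the child relation on a closed ranked finite set;
* `mem_of_reflTransGen_plan` — reachable pairs stay in `Q`;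
* **`exists_isMarkedResolution_finite_plan_cert`** — THE KIT THEOREM.

AI-produced formalisation, weaker than expert review. bears_on: LADDER-RESOLUTION:D157-DOOR2 (res-dim4-pi · S3 (c) joint v2 · kit).
-/

set_option linter.dupNamespace false -- D-0017: single-problem summit path `Summit.<S>.<S>.…` by design

noncomputable section

open MvPolynomial Finset CategoryTheory AlgebraicGeometry Opposite TopologicalSpace

namespace Summit.ResolutionOfSingularities.ResolutionOfSingularities.Theorems.PIDim4

open Literature.AlgebraicGeometry.Resolution
open Literature.AlgebraicGeometry.Resolution.Hauser2010
open Literature.AlgebraicGeometry.Resolution.AffinePointBlowup (P A γ coord Wtop ξ)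

namespace Equimultiple

/-! ## §1 Closed ranked plans -/

section Ranked

variable {K : Type} [Field K] {p : ℕ} [DecidableEq K]

/-- **`Acc` of the child relation from a rank**: on a set `Q` closed under the child map, a rank `rk` that strictly decreases along
plan edges makes every pair of `Q` accessible. [folklore] -/
theorem acc_plan_of_rank (plan : State K → Finset (Fin 4) → Finset (Fin 4 × (Fin 4 → K) × Finset (Fin 4)))
    (Q : Finset (State K × Finset (Fin 4)))
    (hclosed : ∀ q ∈ Q, ∀ e ∈ plan q.1 q.2, (CentreBlowup.step p q.2 e.1 e.2.1 q.1, e.2.2) ∈ Q)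
    (rk : State K × Finset (Fin 4) → ℕ)
    (hrk : ∀ q ∈ Q, ∀ e ∈ plan q.1 q.2, rk (CentreBlowup.step p q.2 e.1 e.2.1 q.1, e.2.2) < rk q) :
    ∀ q ∈ Q, Acc (fun q' q : State K × Finset (Fin 4) =>
      ∃ e ∈ plan q.1 q.2, q' = (CentreBlowup.step p q.2 e.1 e.2.1 q.1, e.2.2)) q := by
  suffices h : ∀ (n : ℕ) (q : State K × Finset (Fin 4)), q ∈ Q → rk q ≤ n →
      Acc (fun q' q : State K × Finset (Fin 4) =>
        ∃ e ∈ plan q.1 q.2, q' = (CentreBlowup.step p q.2 e.1 e.2.1 q.1, e.2.2)) q from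
    fun q hq => h (rk q) q hq le_rfl
  intro n
  induction n with
  | zero =>
    intro q hq hn
    exact Acc.intro _ fun q' ⟨e, he, hq'⟩ => absurd (hn.trans_lt' (hq' ▸ hrk q hq e he)) (Nat.not_lt_zero _)
  | succ n ih =>
    intro q hq hn
    exact Acc.intro _ fun q' ⟨e, he, hq'⟩ =>
      ih q' (hq' ▸ hclosed q hq e he) (Nat.lt_succ_iff.mp ((hq' ▸ hrk q hq e he).trans_le hn))

/-- Pairs reachable along the plan from a pair of a closed set stay in it. [folklore] -/
theorem mem_of_reflTransGen_plan (plan : State K → Finset (Fin 4) → Finset (Fin 4 × (Fin 4 → K) × Finset (Fin 4)))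
    (Q : Finset (State K × Finset (Fin 4)))
    (hclosed : ∀ q ∈ Q, ∀ e ∈ plan q.1 q.2, (CentreBlowup.step p q.2 e.1 e.2.1 q.1, e.2.2) ∈ Q)
    {q₀ q : State K × Finset (Fin 4)} (hq₀ : q₀ ∈ Q)
    (hq : Relation.ReflTransGen (fun q q' : State K × Finset (Fin 4) =>
      ∃ e ∈ plan q.1 q.2, q' = (CentreBlowup.step p q.2 e.1 e.2.1 q.1, e.2.2)) q₀ q) : q ∈ Q := by
  induction hq with
  | refl => exact hq₀
  | tail _ hR ih =>
    obtain ⟨e, he, rfl⟩ := hR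
    exact hclosed _ ih e he

end Ranked

/-! ## §2 The kit theorem -/

section Kit

variable {K : Type} [Field K] {p : ℕ} [hp : Fact p.Prime] [CharP K p]

/-- **FINITE-PLAN CERTIFICATE KIT (any depth).** `K = K̄` of characteristic `p`, `F ≠ 0` clean; ONE initial member `(b₀, S)` (state
`s₀`, `V(z, x_S)` permissible, carrying every root parameter); rules `plan`, `leaves`; a finite set `Q` of pairs containing `(s₀, S)`
and closed under the child map, with a rank strictly decreasing along plan edges; FOR EVERY PAIR OF `Q`: the entries are admissible
(`j ∈ S′`, `b_j = 0`, `S′ ⊆ S″`, equimultiple, `S″` permissible for the child) and pairwise separated, every leaf is DEAD (its state has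
no equimultiple pair for the point centre), and the normalised equimultiple pairs are covered by entries or leaves ⇒
`(𝔸⁵_K, (z^p + F)·𝒪, [], p)` admits a marked resolution (BGMW Def. 3.1.3). [cite: BierstoneGrigorievMilmanWlodarczyk2011, Def. 3.1.3]
[cite: HauserPerlega2019PRIMS, §2] [cite: Hauser2010, §F (equiconstant points)] -/
theorem exists_isMarkedResolution_finite_plan_cert [IsAlgClosed K] [DecidableEq K] (F : MvPolynomial (Fin 4) K) (hF : F ≠ 0)
    (hclean : Literature.Barriers.ResolutionOfSingularities.HauserPerlega.IsClean p F) (b₀ : Fin 4 → K) (S : Finset (Fin 4))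
    (s₀ : State K) (hs₀ : s₀ = ⟨deletePthPowers p (PointBlowup.translate b₀ F), 0, ∅⟩)
    (hS : IsPermissibleCentre p S s₀.F)
    (hroots : ∀ b' : Fin 4 → K, (∀ d : Fin 4 →₀ ℕ, d ≠ 0 → d.degree < p → coeff d (PointBlowup.translate b' F) = 0) →
      ∀ i ∈ S, b' i = b₀ i)
    (plan : State K → Finset (Fin 4) → Finset (Fin 4 × (Fin 4 → K) × Finset (Fin 4)))
    (leaves : State K → Finset (Fin 4) → Finset (Fin 4 × (Fin 4 → K)))
    (Q : Finset (State K × Finset (Fin 4))) (hq₀ : (s₀, S) ∈ Q)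
    (hclosed : ∀ q ∈ Q, ∀ e ∈ plan q.1 q.2, (CentreBlowup.step p q.2 e.1 e.2.1 q.1, e.2.2) ∈ Q)
    (rk : State K × Finset (Fin 4) → ℕ)
    (hrk : ∀ q ∈ Q, ∀ e ∈ plan q.1 q.2, rk (CentreBlowup.step p q.2 e.1 e.2.1 q.1, e.2.2) < rk q)
    (hP1 : ∀ q ∈ Q, ∀ e ∈ plan q.1 q.2, e.1 ∈ q.2 ∧ e.2.1 e.1 = 0 ∧ q.2 ⊆ e.2.2 ∧
      CentreBlowup.IsEquimultiplePoint p q.2 e.1 e.2.1 q.1 ∧ IsPermissibleCentre p e.2.2 (CentreBlowup.step p q.2 e.1 e.2.1 q.1).F)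
    (hP2 : ∀ q ∈ Q, ∀ e ∈ plan q.1 q.2, ∀ e' ∈ plan q.1 q.2, e ≠ e' →
      (e.1 = e'.1 ∧ ∃ i ∈ e.2.2, i ∈ e'.2.2 ∧ e.2.1 i ≠ e'.2.1 i) ∨
      (e.1 ≠ e'.1 ∧ ((e'.2.1 e.1 = 0 ∧ e.1 ∈ e'.2.2) ∨ (e.2.1 e'.1 = 0 ∧ e'.1 ∈ e.2.2))))
    (hdead : ∀ q ∈ Q, ∀ l ∈ leaves q.1 q.2, ∀ (k : Fin 4) (c : Fin 4 → K), c k = 0 →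
      ¬ CentreBlowup.IsEquimultiplePoint p Finset.univ k c (CentreBlowup.step p q.2 l.1 l.2 q.1))
    (hcover : ∀ q ∈ Q, ∀ (j' : Fin 4) (b' : Fin 4 → K), j' ∈ q.2 → b' j' = 0 → (∀ k ∈ q.2, k < j' → b' k = 0) →
      CentreBlowup.IsEquimultiplePoint p q.2 j' b' q.1 →
      (∃ e ∈ plan q.1 q.2, e.1 = j' ∧ ∀ i ∈ e.2.2, b' i = e.2.1 i) ∨ (j', b') ∈ leaves q.1 q.2) :
    ∃ (X' : Scheme.{0}) (ρ : X' ⟶ P 4 K) (M' : MarkedIdeal X'),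
      IsMarkedResolution (⟨hypSheaf p F, [], p⟩ : MarkedIdeal (P 4 K)) ρ M' := by
  classical
  have hS' : IsPermissibleCentre p S (deletePthPowers p (PointBlowup.translate b₀ F)) := by rw [hs₀] at hS; exact hS
  refine exists_isMarkedResolution_joint_forest_root_normalised F hF hclean plan leaves {(b₀, S)} (fun bS hbS => ?_)
    (fun bS hbS bS' hbS' hne' => ?_) (Set.finite_empty.subset ?_) (fun b' H hoff => ?_)
  · -- the member
    rw [Finset.mem_singleton] at hbS
    subst hbS
    dsimp only
    rw [← hs₀]
    refine ⟨hS', fun q hq => ?_, acc_plan_of_rank plan Q hclosed rk hrk _ hq₀⟩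
    have hqQ : q ∈ Q := mem_of_reflTransGen_plan plan Q hclosed hq₀ hq
    exact ⟨hP1 q hqQ, hP2 q hqQ, fun l hl _ => ⟨acc_edge_of_no_pairs _ (hdead q hqQ l hl),
      fun s' hs' => finite_pairs_of_no_pairs _ (hdead q hqQ l hl) s' hs'⟩, hcover q hqQ⟩
  · -- one member only
    rw [Finset.mem_singleton] at hbS hbS'
    exact absurd (hbS.trans hbS'.symm) hne'
  · rintro b' ⟨H, hoff'⟩
    exact hoff' (b₀, S) (Finset.mem_singleton_self _) (hroots b' H)
  · exfalso
    exact hoff (b₀, S) (Finset.mem_singleton_self _) (hroots b' H)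

end Kit

end Equimultiple

end Summit.ResolutionOfSingularities.ResolutionOfSingularities.Theorems.PIDim4

end
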